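import Summits.Ventures.AbcSig.Rows.X7Y7C29Desc7

/-!
# Venture AbcSig — DESC7 SCHEMA: `x⁷ + y⁷ = q·m·z²` for ONE prime `q ≡ 1 (mod 7)` (any such `q`), GIVEN rank-0 quotients

HONEST FRAMING. Conditional theorem schema of a computation cell (`pub-abcsig`), continuing `Rows/X7Y7C29Desc7.lean`
(engine-2 g18, module «DESC7», ADOPTED-DERIVED by lead RULING DESC7-2; no claim on ABC or any summit; not a row of record).
KERNEL-PROVED here for an ARBITRARY prime `q ∉ {2, 7}` (in the applications `q ≡ 1 (mod 7)`): the descent `descentQm` —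
a solution of `x⁷ + y⁷ = q·m·z²` (`x, y` coprime, `z ≠ 0`, `7 ∤ m`, `q ∤ m`, `m` coprime to `H(x, y)`) gives
`H(x, y) = δ·w²` with `δ ∈ {1, 7, q, 7q}` — and the two quotient maps for general `δ`, so that the equation is
excluded GIVEN: (H1, CITED) `ivorra2007_cyclotomicCurves` (both clauses, for `δ ∈ {1, 7}`); (H2) for `δ = q`, the
absence of affine rational points on `E⁺_q : V² = U³ + 14qU² + 49q²U + 49q³` OR on `E⁻_q : V² = U³ + 6qU² + 5q²U + q³`;
(H3) the same for `δ = 7q`. H2/H3 are COMPUTED per `q` by engine-2's desc7.py (rank 0 by `L(E,1) ≠ 0` + [Kolyvagin /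
Gross–Zagier] on [BCDT 2001], torsion by `Ẽ(𝔽_p)`; PARI 2-descent as labelled cross-check) — of record for
`q ∈ {29, 197}` and, own-engine, for `q ∈ {701, 757, 827, 883, 1051, 1163, 1373, 1429, 1499, 1709, 1723, 1877, 1933}`
(STRUCTURE «DESC7 SCHEMA»); by the DESC7-W law no such hypothesis can hold for `q ≡ ±1 (mod 8)`.
engine-2 g18 (prover-pub-abcsig-eng-2-g18-0), 2026-08-25.
-/

namespace Summit.Ventures.AbcSig.Desc7

open Polynomial

/-- `7` is prime in `ℤ` (local copy). -/
private theorem prime_seven'' : Prime (7 : ℤ) := Int.prime_iff_natAbs_prime.mpr (by norm_num)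

/-- From `P · R = c²` with `P, R` coprime and `P > 0`: `P` is a square (local copy). -/
private theorem sq_of_coprime_pos'' {P R c : ℤ} (hcop : IsCoprime P R) (heq : P * R = c ^ 2) (hpos : 0 < P) :
    ∃ w : ℤ, P = w ^ 2 := by
  obtain ⟨w, hw | hw⟩ := Int.sq_of_isCoprime hcop heq
  · exact ⟨w, hw⟩
  · exfalso; nlinarith [sq_nonneg w]

/-- **Descent lemma, one prime `q ≠ 7`** (RECORD-DESC7 §1 at `C = q·m`, `7 ∤ m`, `q ∤ m`, `m` coprime to `H(x, y)`): a
solution of `x⁷ + y⁷ = q m z²` with `x, y` coprime and `z ≠ 0` gives `H(x, y) = δ w²` with `δ ∈ {1, 7, q, 7q}`. -/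
theorem descentQm (q : ℕ) (hq : q.Prime) (hq7 : q ≠ 7) (m a b c : ℤ) (h7m : ¬ (7 : ℤ) ∣ m)
    (hqm : ¬ (q : ℤ) ∣ m) (hmH : IsCoprime m (H7 a b))
    (heq : a ^ 7 + b ^ 7 = q * m * c ^ 2) (hab : IsCoprime a b) (hc0 : c ≠ 0) :
    ∃ δ : ℤ, (δ = 1 ∨ δ = 7 ∨ δ = q ∨ δ = 7 * q) ∧ ∃ w : ℤ, H7 a b = δ * w ^ 2 := by
  have hqP : Prime (q : ℤ) := Int.prime_iff_natAbs_prime.mpr (by simpa using hq)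
  have hq0 : (q : ℤ) ≠ 0 := by exact_mod_cast hq.ne_zero
  have h7q : ¬ (7 : ℤ) ∣ (q : ℤ) := by
    intro h
    have h1 : (7 : ℕ) ∣ q := by exact_mod_cast h
    rcases (Nat.dvd_prime hq).mp h1 with h2 | h2
    · norm_num at h2
    · exact hq7 h2.symm
  have hm0 : m ≠ 0 := by
    rintro rfl; exact h7m (dvd_zero 7)
  have hprod : (a + b) * H7 a b = (q : ℤ) * m * c ^ 2 := by rw [H7_mul, heq]
  have hsum : a + b ≠ 0 := by
    intro h0
    have h1 : (q : ℤ) * m * c ^ 2 = 0 := by rw [← hprod, h0, zero_mul]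
    have h2 : c ^ 2 ≠ 0 := pow_ne_zero 2 hc0
    have h3 : (q : ℤ) * m ≠ 0 := mul_ne_zero hq0 hm0
    exact (mul_ne_zero h3 h2) h1
  have hHpos : 0 < H7 a b := H7_pos a b hsum
  -- `a + b` is coprime to `b`, hence to `b⁶`
  have hcop_b : IsCoprime (a + b) b := by
    have := hab.symm.add_mul_left_right 1
    simpa [mul_one] using this.symm
  have hcop_b6 : IsCoprime (a + b) (b ^ 6) := hcop_b.pow_right
  have hmH' : IsCoprime (H7 a b) m := hmH.symm
  by_cases h7 : (7 : ℤ) ∣ a + b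
  · -- Case 7 ∣ a + b :  H = 7 · H'' with 7 ∤ H''
    obtain ⟨u, hu⟩ := h7
    set H'' : ℤ := u * Q7 a b + b ^ 6 with hH''def
    have hHfac : H7 a b = 7 * H'' := by rw [H7_taylor, hu, hH''def]; ring
    have h7b : ¬ (7 : ℤ) ∣ b := by
      have h1 : IsCoprime (7 * u) b := by rw [← hu]; exact hcop_b
      exact (Prime.coprime_iff_not_dvd prime_seven'').mp h1.of_mul_left_left
    have hQ : Q7 a b = 7 * (-3 * b ^ 5 + 5 * b ^ 4 * (a + b) - 5 * b ^ 3 * (a + b) ^ 2 + 3 * b ^ 2 * (a + b) ^ 3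
        - b * (a + b) ^ 4 + 7 ^ 4 * u ^ 5) := by
      have ha' : a = 7 * u - b := by linarith
      unfold Q7; rw [ha']; ring
    have h7H'' : ¬ (7 : ℤ) ∣ H'' := by
      intro hd
      have hQ7 : (7 : ℤ) ∣ Q7 a b := ⟨_, hQ⟩
      have : (7 : ℤ) ∣ b ^ 6 := by
        have e : b ^ 6 = H'' - u * Q7 a b := by rw [hH''def]; ring
        rw [e]
        exact dvd_sub hd (dvd_mul_of_dvd_right hQ7 u)
      exact h7b (prime_seven''.dvd_of_dvd_pow this)
    have hH''pos : 0 < H'' := by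
      have : 0 < 7 * H'' := by rw [← hHfac]; exact hHpos
      linarith
    have hH''m : IsCoprime H'' m := by
      have : IsCoprime (7 * H'') m := by rw [← hHfac]; exact hmH'
      exact this.of_mul_left_right
    -- 49 u H'' = 29 m c², so 7 ∣ c
    have h49 : 49 * (u * H'') = (q : ℤ) * m * c ^ 2 := by
      have := hprod; rw [hu, hHfac] at this; linarith
    have h7c : (7 : ℤ) ∣ c := by
      have h1 : (7 : ℤ) ∣ (q : ℤ) * m * c ^ 2 := ⟨7 * (u * H''), by linarith⟩
      rcases prime_seven''.dvd_or_dvd h1 with h2 | h2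
      · rcases prime_seven''.dvd_or_dvd h2 with h3 | h3
        · exact absurd h3 h7q
        · exact absurd h3 h7m
      · exact prime_seven''.dvd_of_dvd_pow h2
    obtain ⟨c', hc'⟩ := h7c
    have hprod' : u * H'' = (q : ℤ) * m * c' ^ 2 := by
      rw [hc'] at h49; nlinarith
    -- u and H'' are coprime
    have hcop_u : IsCoprime u H'' := by
      have h1 : IsCoprime (7 * u) (b ^ 6) := by rw [← hu]; exact hcop_b6
      have h2 : IsCoprime u (b ^ 6) := h1.of_mul_left_right
      have h3 := h2.add_mul_left_right (Q7 a b)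
      have e : b ^ 6 + u * Q7 a b = H'' := by rw [hH''def]; ring
      rwa [e] at h3
    by_cases h29 : (q : ℤ) ∣ H''
    · -- δ = 203
      obtain ⟨K, hK⟩ := h29
      have hKpos : 0 < K := by nlinarith
      have hcopK : IsCoprime K (m * u) := by
        have h1 : IsCoprime u ((q : ℤ) * K) := by rw [← hK]; exact hcop_u
        have h2 : IsCoprime ((q : ℤ) * K) m := by rw [← hK]; exact hH''m
        exact (h2.of_mul_left_right).mul_right h1.of_mul_right_right.symm
      have heqK : K * (m * u) = (m * c') ^ 2 := by
        have h1 : u * ((q : ℤ) * K) = (q : ℤ) * m * c' ^ 2 := by rw [← hK]; exact hprod'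
        have h2 : u * K = m * c' ^ 2 := by
          have h3 : (q : ℤ) * (u * K) = (q : ℤ) * (m * c' ^ 2) := by linear_combination h1
          exact mul_left_cancel₀ hq0 h3
        linear_combination m * h2
      obtain ⟨w, hw⟩ := sq_of_coprime_pos'' hcopK heqK hKpos
      refine ⟨7 * q, by simp, w, ?_⟩
      rw [hHfac, hK, hw]; ring
    · -- δ = 7
      have hcop29 : IsCoprime (q : ℤ) H'' := (Prime.coprime_iff_not_dvd hqP).mpr h29
      have hcopAll : IsCoprime H'' ((q : ℤ) * m * u) := (hcop29.symm.mul_right hH''m).mul_right hcop_u.symm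
      have heq2 : H'' * ((q : ℤ) * m * u) = ((q : ℤ) * m * c') ^ 2 := by linear_combination ((q : ℤ) * m) * hprod'
      obtain ⟨w, hw⟩ := sq_of_coprime_pos'' hcopAll heq2 hH''pos
      refine ⟨7, by simp, w, ?_⟩
      rw [hHfac, hw]
  · -- Case 7 ∤ a + b :  (a + b) and H coprime
    have hcop7 : IsCoprime (a + b) 7 := ((Prime.coprime_iff_not_dvd prime_seven'').mpr h7).symm
    have hcopH : IsCoprime (a + b) (H7 a b) := by
      have h1 : IsCoprime (a + b) (7 * b ^ 6) := hcop7.mul_right hcop_b6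
      have h2 := h1.add_mul_left_right (Q7 a b)
      rwa [← H7_taylor] at h2
    by_cases h29 : (q : ℤ) ∣ H7 a b
    · -- δ = 29
      obtain ⟨K, hK⟩ := h29
      have hKpos : 0 < K := by nlinarith
      have hcopK : IsCoprime K (m * (a + b)) := by
        have h1 : IsCoprime (a + b) ((q : ℤ) * K) := by rw [← hK]; exact hcopH
        have h2 : IsCoprime ((q : ℤ) * K) m := by rw [← hK]; exact hmH'
        exact (h2.of_mul_left_right).mul_right h1.of_mul_right_right.symm
      have heqK : K * (m * (a + b)) = (m * c) ^ 2 := by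
        have h1 : (a + b) * ((q : ℤ) * K) = (q : ℤ) * m * c ^ 2 := by rw [← hK]; exact hprod
        have h2 : (a + b) * K = m * c ^ 2 := by
          have h3 : (q : ℤ) * ((a + b) * K) = (q : ℤ) * (m * c ^ 2) := by linear_combination h1
          exact mul_left_cancel₀ hq0 h3
        linear_combination m * h2
      obtain ⟨w, hw⟩ := sq_of_coprime_pos'' hcopK heqK hKpos
      exact ⟨q, by simp, w, by rw [hK, hw]⟩
    · -- δ = 1
      have hcop29 : IsCoprime (q : ℤ) (H7 a b) := (Prime.coprime_iff_not_dvd hqP).mpr h29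
      have hcopAll : IsCoprime (H7 a b) ((q : ℤ) * m * (a + b)) :=
        (hcop29.symm.mul_right hmH').mul_right hcopH.symm
      have heq2 : H7 a b * ((q : ℤ) * m * (a + b)) = ((q : ℤ) * m * c) ^ 2 := by linear_combination ((q : ℤ) * m) * hprod
      obtain ⟨w, hw⟩ := sq_of_coprime_pos'' hcopAll heq2 hHpos
      exact ⟨1, by simp, w, by rw [hw]; ring⟩

/-- **DESC7 SCHEMA for `C = q·m`** (`q` prime, `q ∉ {2, 7}`; `m ≥ 1`, `7 ∤ m`, `q ∤ m`, `m` coprime to every `H(x, y)` at coprime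
`x, y`): `x⁷ + y⁷ = q m z²` has no primitive solution GIVEN Ivorra's `C₇(ℚ)`, `D₇(ℚ)` (CITED) and, for each of `δ = q` and
`δ = 7q`, the absence of affine rational points on ONE of the two elliptic quotients `E⁺_δ`, `E⁻_δ` (COMPUTED per `q`). -/
theorem x7y7_eq_qm_zsq_desc7 (q : ℕ) (hq : q.Prime) (hq2 : q ≠ 2) (hq7 : q ≠ 7) (m : ℕ) (hm : 1 ≤ m)
    (h7m : ¬ (7 : ℤ) ∣ (m : ℤ)) (hqm : ¬ (q : ℤ) ∣ (m : ℤ))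
    (hmH : ∀ a b : ℤ, IsCoprime a b → IsCoprime (m : ℤ) (H7 a b))
    (hI : Literature.NumberTheory.DiophantineGeometry.ivorra2007_cyclotomicCurves)
    (hEq : (∀ U V : ℚ, V ^ 2 ≠ U ^ 3 + 14 * q * U ^ 2 + 49 * q ^ 2 * U + 49 * q ^ 3) ∨
           (∀ U V : ℚ, V ^ 2 ≠ U ^ 3 + 6 * q * U ^ 2 + 5 * q ^ 2 * U + q ^ 3))
    (hE7q : (∀ U V : ℚ, V ^ 2 ≠ U ^ 3 + 14 * (7 * q) * U ^ 2 + 49 * (7 * q) ^ 2 * U + 49 * (7 * q) ^ 3) ∨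
            (∀ U V : ℚ, V ^ 2 ≠ U ^ 3 + 6 * (7 * q) * U ^ 2 + 5 * (7 * q) ^ 2 * U + (7 * q) ^ 3))
    (a b c : ℤ) : ¬ IsPrimitiveSolution 1 1 (q * m) 7 a b c := by
  intro hsol
  obtain ⟨heq, ha, hb, hc, hab, hac, hbc⟩ := hsol
  simp only [Nat.cast_one, one_mul, Nat.cast_mul] at heq ha hb hc hab hac hbc
  have hm0 : (m : ℤ) ≠ 0 := by exact_mod_cast (by omega : m ≠ 0)
  have hq3 : (3 : ℤ) ≤ q := by
    have : 3 ≤ q := by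
      rcases Nat.lt_or_ge q 3 with h | h
      · exfalso; interval_cases q <;> simp_all (config := {decide := true})
      · exact h
    exact_mod_cast this
  have hq0 : (q : ℤ) ≠ 0 := by exact_mod_cast hq.ne_zero
  have hc0 : c ≠ 0 := by intro h0; apply hc; rw [h0]; ring
  obtain ⟨δ, hδ, w, hw⟩ := descentQm q hq hq7 m a b c h7m hqm (hmH a b hab) (by rw [heq]) hab hc0
  -- a ≠ b and a ≠ -b
  have hne1 : a ≠ b := by
    intro h1
    have hu : IsUnit a := by
      have : IsCoprime a a := by simpa [h1] using hab
      exact (isCoprime_self).mp this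
    have hc2 : 0 < c ^ 2 := sq_pos_iff.mpr hc0
    have hm1 : (1 : ℤ) ≤ m := by exact_mod_cast hm
    have hc3 : (1 : ℤ) ≤ c ^ 2 := hc2
    rcases Int.isUnit_iff.mp hu with h2 | h2
    · have h3 : (q : ℤ) * m * c ^ 2 = 2 := by rw [← heq, ← h1, h2]; norm_num
      nlinarith [mul_le_mul hq3 hm1 (by norm_num) (by positivity), mul_le_mul (le_refl ((q:ℤ) * m)) hc3 (by norm_num) (by positivity)]
    · have h3 : (q : ℤ) * m * c ^ 2 = -2 := by rw [← heq, ← h1, h2]; norm_num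
      nlinarith [mul_le_mul hq3 hm1 (by norm_num) (by positivity), mul_le_mul (le_refl ((q:ℤ) * m)) hc3 (by norm_num) (by positivity)]
  have hne2 : a + b ≠ 0 := by
    intro h0
    have hb' : b = -a := by linarith
    have h1 : (q : ℤ) * m * c ^ 2 = 0 := by rw [← heq, hb']; ring
    have h2 : c ^ 2 ≠ 0 := pow_ne_zero 2 hc0
    exact (mul_ne_zero (mul_ne_zero hq0 hm0) h2) h1
  -- the rational point (t, Y) on δ Y² = Φ₁₄(t)
  set t : ℚ := (a : ℚ) / b with ht
  set Y : ℚ := (w : ℚ) / (b : ℚ) ^ 3 with hY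
  have hbq : (b : ℚ) ≠ 0 := by exact_mod_cast hb
  have hwq : ((H7 a b : ℤ) : ℚ) = (δ : ℚ) * (w : ℚ) ^ 2 := by exact_mod_cast hw
  have hHq : ((H7 a b : ℤ) : ℚ) = (a : ℚ) ^ 6 - (a : ℚ) ^ 5 * b + (a : ℚ) ^ 4 * (b : ℚ) ^ 2
      - (a : ℚ) ^ 3 * (b : ℚ) ^ 3 + (a : ℚ) ^ 2 * (b : ℚ) ^ 4 - a * (b : ℚ) ^ 5 + (b : ℚ) ^ 6 := by
    unfold H7; push_cast; ring
  have hcurve : (δ : ℚ) * Y ^ 2 = t ^ 6 - t ^ 5 + t ^ 4 - t ^ 3 + t ^ 2 - t + 1 := by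
    rw [ht, hY]
    field_simp
    linear_combination (-1 : ℚ) * hwq + hHq
  have ht1 : t ≠ 1 := by
    intro h1; apply hne1
    have : (a : ℚ) = b := by rw [ht] at h1; field_simp at h1; linarith
    exact_mod_cast this
  have htm1 : t ≠ -1 := by
    intro h1; apply hne2
    have : (a : ℚ) = -b := by rw [ht] at h1; field_simp at h1; linarith
    exact_mod_cast (by push_cast; linarith : ((a + b : ℤ) : ℚ) = 0)
  have ht0 : t ≠ 0 := by
    intro h0; apply ha
    have : (a : ℚ) = 0 := by rw [ht] at h0; field_simp at h0; simpa using h0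
    exact_mod_cast this
  have h7mem : (7 : ℕ) ∈ ({7, 11, 13, 17} : Finset ℕ) := by decide
  rcases hδ with rfl | rfl | rfl | rfl
  · -- δ = 1 : (−t, Y) ∈ C₇(ℚ) ⇒ −t ∈ {−1, 0}
    have hC := (hI 7 h7mem (-t) Y).1
    have hpt : Y ^ 2 = (Polynomial.cyclotomic 7 ℚ).eval (-t) := by
      rw [cyclotomic7_eval_neg]; push_cast at hcurve; linarith
    rcases (hC hpt).1 with h1 | h1
    · exact ht1 (by linarith)
    · exact ht0 (by linarith)
  · -- δ = 7 : (−t, Y) ∈ D₇(ℚ) ⇒ −t = 1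
    have hD := (hI 7 h7mem (-t) Y).2
    have hpt : ((7 : ℕ) : ℚ) * Y ^ 2 = (Polynomial.cyclotomic 7 ℚ).eval (-t) := by
      rw [cyclotomic7_eval_neg]; push_cast at hcurve ⊢; linarith
    exact htm1 (by linarith [(hD hpt).1])
  · -- δ = q : one of the two quotients has no affine rational point
    rcases hEq with hE | hE
    · -- φ⁺
      have hd : t + 1 ≠ 0 := by
        intro h0; exact htm1 (by linarith)
      apply hE (-7 * q * t / (t + 1) ^ 2) (7 * q ^ 2 * Y / (t + 1) ^ 3)
      have key : (7 * (q : ℚ) ^ 2 * Y / (t + 1) ^ 3) ^ 2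
          - ((-7 * q * t / (t + 1) ^ 2) ^ 3 + 14 * q * (-7 * q * t / (t + 1) ^ 2) ^ 2
              + 49 * q ^ 2 * (-7 * q * t / (t + 1) ^ 2) + 49 * q ^ 3)
          = 49 * (q : ℚ) ^ 3 * ((q : ℚ) * Y ^ 2 - (t ^ 6 - t ^ 5 + t ^ 4 - t ^ 3 + t ^ 2 - t + 1)) / (t + 1) ^ 6 := by
        field_simp
        ring
      have hz : (q : ℚ) * Y ^ 2 - (t ^ 6 - t ^ 5 + t ^ 4 - t ^ 3 + t ^ 2 - t + 1) = 0 := by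
        push_cast at hcurve; linarith
      rw [hz, mul_zero, zero_div] at key
      linarith
    · -- φ⁻
      have hd : t - 1 ≠ 0 := sub_ne_zero.mpr ht1
      apply hE (q * t / (t - 1) ^ 2) (q ^ 2 * Y / (t - 1) ^ 3)
      have key : ((q : ℚ) ^ 2 * Y / (t - 1) ^ 3) ^ 2
          - ((q * t / (t - 1) ^ 2) ^ 3 + 6 * q * (q * t / (t - 1) ^ 2) ^ 2 + 5 * q ^ 2 * (q * t / (t - 1) ^ 2) + q ^ 3)
          = (q : ℚ) ^ 3 * ((q : ℚ) * Y ^ 2 - (t ^ 6 - t ^ 5 + t ^ 4 - t ^ 3 + t ^ 2 - t + 1)) / (t - 1) ^ 6 := by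
        field_simp
        ring
      have hz : (q : ℚ) * Y ^ 2 - (t ^ 6 - t ^ 5 + t ^ 4 - t ^ 3 + t ^ 2 - t + 1) = 0 := by
        push_cast at hcurve; linarith
      rw [hz, mul_zero, zero_div] at key
      linarith
  · -- δ = 7q : likewise
    rcases hE7q with hE | hE
    · have hd : t + 1 ≠ 0 := by
        intro h0; exact htm1 (by linarith)
      apply hE (-7 * (7 * q) * t / (t + 1) ^ 2) (7 * (7 * q) ^ 2 * Y / (t + 1) ^ 3)
      have key : (7 * (7 * (q : ℚ)) ^ 2 * Y / (t + 1) ^ 3) ^ 2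
          - ((-7 * (7 * q) * t / (t + 1) ^ 2) ^ 3 + 14 * (7 * q) * (-7 * (7 * q) * t / (t + 1) ^ 2) ^ 2
              + 49 * (7 * q) ^ 2 * (-7 * (7 * q) * t / (t + 1) ^ 2) + 49 * (7 * q) ^ 3)
          = 49 * (7 * (q : ℚ)) ^ 3 * ((7 * (q : ℚ)) * Y ^ 2 - (t ^ 6 - t ^ 5 + t ^ 4 - t ^ 3 + t ^ 2 - t + 1)) / (t + 1) ^ 6 := by
        field_simp
        ring
      have hz : (7 * (q : ℚ)) * Y ^ 2 - (t ^ 6 - t ^ 5 + t ^ 4 - t ^ 3 + t ^ 2 - t + 1) = 0 := by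
        push_cast at hcurve; linarith
      rw [hz, mul_zero, zero_div] at key
      linarith
    · have hd : t - 1 ≠ 0 := sub_ne_zero.mpr ht1
      apply hE ((7 * q) * t / (t - 1) ^ 2) ((7 * q) ^ 2 * Y / (t - 1) ^ 3)
      have key : ((7 * (q : ℚ)) ^ 2 * Y / (t - 1) ^ 3) ^ 2
          - (((7 * q) * t / (t - 1) ^ 2) ^ 3 + 6 * (7 * q) * ((7 * q) * t / (t - 1) ^ 2) ^ 2
              + 5 * (7 * q) ^ 2 * ((7 * q) * t / (t - 1) ^ 2) + (7 * q) ^ 3)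
          = (7 * (q : ℚ)) ^ 3 * ((7 * (q : ℚ)) * Y ^ 2 - (t ^ 6 - t ^ 5 + t ^ 4 - t ^ 3 + t ^ 2 - t + 1)) / (t - 1) ^ 6 := by
        field_simp
        ring
      have hz : (7 * (q : ℚ)) * Y ^ 2 - (t ^ 6 - t ^ 5 + t ^ 4 - t ^ 3 + t ^ 2 - t + 1) = 0 := by
        push_cast at hcurve; linarith
      rw [hz, mul_zero, zero_div] at key
      linarith

/-- The `C = 29` theorem of the first file is the instance `q = 29`, `m = 1` of the schema (sanity check of the schema's
hypothesis shapes: `E⁻₂₉` for `δ = 29`, `E⁺₂₀₃` for `δ = 203`). -/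
example (hI : Literature.NumberTheory.DiophantineGeometry.ivorra2007_cyclotomicCurves)
    (hE29 : ∀ U V : ℚ, V ^ 2 ≠ U ^ 3 + 174 * U ^ 2 + 4205 * U + 24389)
    (hE203 : ∀ U V : ℚ, V ^ 2 ≠ U ^ 3 + 2842 * U ^ 2 + 2019241 * U + 409905923)
    (a b c : ℤ) : ¬ IsPrimitiveSolution 1 1 29 7 a b c := by
  have h := x7y7_eq_qm_zsq_desc7 29 (by norm_num) (by norm_num) (by norm_num) 1 le_rfl (by decide) (by decide)
    (fun a b _ => isCoprime_one_left) hI (Or.inr (by intro U V; have := hE29 U V; push_cast; ring_nf at this ⊢; exact this))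
    (Or.inl (by intro U V; have := hE203 U V; push_cast; ring_nf at this ⊢; exact this)) a b c
  simpa using h

end Summit.Ventures.AbcSig.Desc7
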